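import Mathlib
import HarnessLib

/-!
# Route `KLProgramme` — engine support, route (L2), FAT layer 4a: monotonicity of the multiplier-data polynomials in the step data — the
# pair-dependent quantities (step norms, tangency datum, index-set sizes) are replaced by uniform bounds

Cell `gate-hubbard-kl`, seat hubbard-kl-k3c2-p3; gen-4 ENGINE child stmt-HubbardSuperconductivity-19855 (`stub_engine_step_norms`, propagator
`α_n`).  The per-pair multiplier data of `…FatMultiplierPack` and the Leibniz left-hand sides of `slicePair_charSum_l1_le` are polynomials
with nonnegative coefficients in the step norms `‖w‖`, `‖w₁+iw₂‖`, `‖toLp w‖`, the tangency datum `τ₀` (resp. `τ`) and the index-set size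
`|S₁||S₂|`; this file records that they are monotone in these arguments, so that a row/column sum over sector pairs can use ONE set of
rates.  Pure real-inequality lemmas; no definitions. [folklore]
-/

noncomputable section

namespace Summit.HubbardSuperconductivity.HubbardSuperconductivity.Theorems.TorusFourierL2

set_option linter.dupNamespace false -- summit = problem name (single-conjunct summit), D-0017

/-- **Monotonicity of the second-difference multiplier datum** of `norm_fwdDiff_two_space_fatPair_le` in `(τ₀, ‖w‖, ‖w₁+iw₂‖, |S₁||S₂|)`.
[folklore] -/
theorem fatPair_a2_mono {G₁ G₂ Kp ρ Λm Ba wsi τ₀ τ₀' nw nw' nc nc' cd cd' : ℝ}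
    (hG₁ : 0 ≤ G₁) (hG₂ : 0 ≤ G₂) (hKp : 0 ≤ Kp) (hρ : 0 ≤ ρ) (hΛm : 0 < Λm) (hBa : 0 ≤ Ba) (hwsi : 0 ≤ wsi)
    (hτ₀ : 0 ≤ τ₀) (hτ : τ₀ ≤ τ₀') (hnw0 : 0 ≤ nw) (hnw : nw ≤ nw') (hnc0 : 0 ≤ nc) (hnc : nc ≤ nc') (hcd0 : 0 ≤ cd) (hcd : cd ≤ cd') :
    ((4 * G₂ + 2 * G₁) * (τ₀ + Kp * (ρ + 2 * nw) * nw) ^ 2 / Λm ^ 2 + 2 * G₁ * (Kp * nw ^ 2) / Λm) * 1 +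
        4 * G₁ * (τ₀ + Kp * (ρ + 2 * nw) * nw) / Λm * (cd * (4 * Ba * ((1 + 2 * wsi) * nc))) +
        1 * 1 * (cd * (4 * Ba * ((1 + 2 * wsi) * nc) ^ 2 + 8 * Ba ^ 2 * ((1 + 2 * wsi) * nc) ^ 2)) ≤
      ((4 * G₂ + 2 * G₁) * (τ₀' + Kp * (ρ + 2 * nw') * nw') ^ 2 / Λm ^ 2 + 2 * G₁ * (Kp * nw' ^ 2) / Λm) * 1 +
        4 * G₁ * (τ₀' + Kp * (ρ + 2 * nw') * nw') / Λm * (cd' * (4 * Ba * ((1 + 2 * wsi) * nc'))) +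
        1 * 1 * (cd' * (4 * Ba * ((1 + 2 * wsi) * nc') ^ 2 + 8 * Ba ^ 2 * ((1 + 2 * wsi) * nc') ^ 2)) := by
  have h1 : τ₀ + Kp * (ρ + 2 * nw) * nw ≤ τ₀' + Kp * (ρ + 2 * nw') * nw' := by
    have : Kp * (ρ + 2 * nw) * nw ≤ Kp * (ρ + 2 * nw') * nw' := by
      have := mul_le_mul (show ρ + 2 * nw ≤ ρ + 2 * nw' by linarith) hnw hnw0 (by linarith)
      exact by rw [mul_assoc, mul_assoc]; exact mul_le_mul_of_nonneg_left this hKp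
    linarith
  have h0 : 0 ≤ τ₀ + Kp * (ρ + 2 * nw) * nw := by positivity
  have h0' : 0 ≤ τ₀' + Kp * (ρ + 2 * nw') * nw' := h0.trans h1
  have hcd0' : 0 ≤ cd' := hcd0.trans hcd
  have h2 : (1 + 2 * wsi) * nc ≤ (1 + 2 * wsi) * nc' := mul_le_mul_of_nonneg_left hnc (by positivity)
  have h20 : 0 ≤ (1 + 2 * wsi) * nc := by positivity
  have h4 : 0 ≤ 4 * G₁ * (τ₀' + Kp * (ρ + 2 * nw') * nw') / Λm := by positivity
  gcongr

/-- **Monotonicity of the first-difference multiplier datum** of `norm_fwdDiff_space_fatPair_le`. [folklore] -/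
theorem fatPair_a1_mono {G₁ Kp ρ Λm Ba wsi τ₀ τ₀' nw nw' nc nc' cd cd' : ℝ}
    (hG₁ : 0 ≤ G₁) (hKp : 0 ≤ Kp) (hρ : 0 ≤ ρ) (hΛm : 0 < Λm) (hBa : 0 ≤ Ba) (hwsi : 0 ≤ wsi)
    (hτ : τ₀ ≤ τ₀') (hnw0 : 0 ≤ nw) (hnw : nw ≤ nw') (hnc0 : 0 ≤ nc) (hnc : nc ≤ nc') (hcd0 : 0 ≤ cd) (hcd : cd ≤ cd') :
    2 * G₁ * (τ₀ + Kp * (ρ + 2 * nw) * nw) / Λm * 1 + 1 * 1 * (cd * (4 * Ba * ((1 + 2 * wsi) * nc))) ≤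
      2 * G₁ * (τ₀' + Kp * (ρ + 2 * nw') * nw') / Λm * 1 + 1 * 1 * (cd' * (4 * Ba * ((1 + 2 * wsi) * nc'))) := by
  have h1 : τ₀ + Kp * (ρ + 2 * nw) * nw ≤ τ₀' + Kp * (ρ + 2 * nw') * nw' := by
    have : Kp * (ρ + 2 * nw) * nw ≤ Kp * (ρ + 2 * nw') * nw' := by
      have := mul_le_mul (show ρ + 2 * nw ≤ ρ + 2 * nw' by linarith) hnw hnw0 (by linarith)
      exact by rw [mul_assoc, mul_assoc]; exact mul_le_mul_of_nonneg_left this hKp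
    linarith
  have h2 : (1 + 2 * wsi) * nc ≤ (1 + 2 * wsi) * nc' := mul_le_mul_of_nonneg_left hnc (by positivity)
  have h20 : 0 ≤ (1 + 2 * wsi) * nc := by positivity
  have hcd0' : 0 ≤ cd' := hcd0.trans hcd
  gcongr

/-- **Monotonicity of the Leibniz left-hand side of `slicePair_charSum_l1_le` (space directions)** in the multiplier data `a₁, a₂`, the
Euclidean step norm `‖toLp w‖` and the tangency datum `τ`. [folklore] -/
theorem slicePair_lhs_mono {c₀n C₂ C₁ c Λ K₂ s₀ a₁ a₁' a₂ a₂' ne ne' τ τ' : ℝ}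
    (hc₀n : 0 ≤ c₀n) (hC₂ : 0 ≤ C₂) (hC₁ : 0 ≤ C₁) (hc : 0 ≤ c) (hΛ : 0 < Λ) (hK₂ : 0 ≤ K₂) (hs₀ : 0 ≤ s₀)
    (ha₁0 : 0 ≤ a₁) (ha₁ : a₁ ≤ a₁') (ha₂ : a₂ ≤ a₂') (hne0 : 0 ≤ ne) (hne : ne ≤ ne') (hτ0 : 0 ≤ τ) (hτ : τ ≤ τ') :
    c₀n * (1 * (C₂ * c / Λ ^ 3 * (τ + 4 * (K₂ * ne ^ 2)) ^ 2 + C₁ * c / Λ ^ 2 * (K₂ * ne ^ 2)) +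
        2 * (a₁ * (C₁ * c / Λ ^ 2 * (τ + s₀ * (K₂ * ne ^ 2)))) + a₂ * (4 * c / Λ)) ≤
      c₀n * (1 * (C₂ * c / Λ ^ 3 * (τ' + 4 * (K₂ * ne' ^ 2)) ^ 2 + C₁ * c / Λ ^ 2 * (K₂ * ne' ^ 2)) +
        2 * (a₁' * (C₁ * c / Λ ^ 2 * (τ' + s₀ * (K₂ * ne' ^ 2)))) + a₂' * (4 * c / Λ)) := by
  have hne2 : ne ^ 2 ≤ ne' ^ 2 := pow_le_pow_left₀ hne0 hne 2
  have hK2 : K₂ * ne ^ 2 ≤ K₂ * ne' ^ 2 := mul_le_mul_of_nonneg_left hne2 hK₂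
  have h1 : τ + 4 * (K₂ * ne ^ 2) ≤ τ' + 4 * (K₂ * ne' ^ 2) := by linarith
  have h10 : 0 ≤ τ + 4 * (K₂ * ne ^ 2) := by positivity
  have h2 : τ + s₀ * (K₂ * ne ^ 2) ≤ τ' + s₀ * (K₂ * ne' ^ 2) := by
    have := mul_le_mul_of_nonneg_left hK2 hs₀; linarith
  have h20 : 0 ≤ τ + s₀ * (K₂ * ne ^ 2) := by positivity
  have ha₁0' : 0 ≤ a₁' := ha₁0.trans ha₁
  gcongr

end Summit.HubbardSuperconductivity.HubbardSuperconductivity.Theorems.TorusFourierL2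

end
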